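import Literature.MathematicalPhysics.QuantumLattice.HeisenbergRPSiteMonotonicity
import HarnessLib

/-!
# Uniform positivity of the Néel correlations on the odd axis sites from a Cesàro bound (Lees–Taggi 2021, Theorem 2 (i))

Topic `MathematicalPhysics/QuantumLattice`; sequel of `HeisenbergRPSiteMonotonicity.lean`
(Lees–Taggi 2021 Thm 4: axis domination, even-site average bound, odd-axis monotonicity of the
ground-state two-point function `c(a, b) = heisRedCorr2 (2k) n a b` of the spin-`n/2` Heisenberg
antiferromagnet on the square torus of side `2k`).

B. Lees, L. Taggi, *Site-monotonicity properties for reflection positive measures with applications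
to quantum spin systems*, J. Stat. Phys. **183** (2021) 38, arXiv:2002.12666 [LeesTaggi2021]; held
text read 2026-08-23: Theorem 2 (i) (abstract RP setting, p. 5 of the arXiv edition) and its proof
(§5, p. 10); §3.1 Theorem 5 (the quantum Heisenberg instance, `d ≥ 3`).

**What is printed (Theorem 2 (i), as PROVED in §5).** Suppose the two-point function is torus
symmetric, reflection positive through edges, bounded by `M`, and has a uniformly positive Cesàro
sum, `|𝕋_L|⁻¹ Σ_x G_L(o, x) ≥ C₁ > 0`. "For any `φ ∈ (0, C₁/2)` there exists `ε > 0` such that for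
any integer `n ∈ (-εL, εL)` … `G_L(o, eᵢ n) ≥ φ`"; the proof (§5) establishes this for ODD `n`
(first an `x ∉ [0, εL]^d` with `G_L(o, x) ≥ φ` by counting, then Theorem 1: axis domination at an odd
coordinate, the average bound at an even one, and the monotonicity along the odd axis sites), and the
quantum instance §3.1 Theorem 5 is stated for "any odd integer `n`". The present file formalises
exactly this argument at `T = 0`, `d = 2`, with the constants explicit, for the staggered
ground-state correlation `G(a, b) = (-1)^{a+b} c(a, b)` of the tree:

* `leesTaggi_uniformPositivity_oddAxis` — **finite form**: on the torus of side `2k`, if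
  `φ (2k)² + (n/2)² (2r+1)(2k) < Σ_{a,b<2k} (-1)^{a+b} c(a, b)` with `0 ≤ φ` and `r + 1 ≤ k`, then
  `φ ≤ -c(m, 0) = G(m, 0)` for every odd `m ≤ r` (and, by `heisRedCorr2_swap`, `φ ≤ -c(0, m)`).

The input "Cesàro sum `≥ C₁ L²` for all large even `L`" is Néel long-range order; it is PROVED in the
tree for `d = 2`, `S ≥ 1` (`kennedy_lieb_shastry_ground_holds`) and OPEN for `S = ½` — this file takes
it as an explicit hypothesis and proves nothing about it. PROVED; no named facts, no numerical input.
(HONEST FRAMING of the cell record `pub-hubbard` that uses these names: ladder R1–R4 with certified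
numbers; no claim on H/H₀.)

## References

* [LeesTaggi2021] B. Lees, L. Taggi, J. Stat. Phys. 183 (2021) 38, Thm 2 (i) and §5; §3.1 Thm 5.
* [DLS1978] F. J. Dyson, E. H. Lieb, B. Simon, J. Stat. Phys. 18 (1978) 335, Theorem 4.2.
* [KLS1988JSP] T. Kennedy, E. H. Lieb, B. S. Shastry, J. Stat. Phys. 53 (1988) 1019, eq. (25).
-/

noncomputable section

open Finset

namespace Literature.MathematicalPhysics.QuantumLattice

/-! ### Monotone chain along the odd axis sites -/

/-- Along the odd axis sites the Néel correlation `-c(m, 0)` is non-increasing up to the middle of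
the torus: for odd `m ≤ m₀ ≤ k` (both odd), `-c(m₀, 0) ≤ -c(m, 0)` — iteration of
`heisRedCorr2_oddAxis_antitone` at `b = 0`. [cite: LeesTaggi2021, Thm 4] -/
theorem heisRedCorr2_oddAxis_chain (k n : ℕ) [NeZero (2 * k)] {m m₀ : ℕ} (hm : Odd m) (hm₀ : Odd m₀)
    (hle : m ≤ m₀) (hk : m₀ ≤ k) :
    -heisRedCorr2 (2 * k) n m₀ 0 ≤ -heisRedCorr2 (2 * k) n m 0 := by
  obtain ⟨i, rfl⟩ := hm
  obtain ⟨i₀, rfl⟩ := hm₀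
  have hii : i ≤ i₀ := by omega
  obtain ⟨j, rfl⟩ := Nat.exists_eq_add_of_le hii
  clear hle hii
  induction j with
  | zero => simp
  | succ j ih =>
    have h1 := ih (by omega)
    have h2 := heisRedCorr2_oddAxis_antitone k n (a := 2 * (i + j) + 1) ⟨i + j, rfl⟩ (by omega) 0
      (ε := 1) (Or.inl rfl)
    have e : 2 * (i + j) + 1 + 2 = 2 * (i + (j + 1)) + 1 := by ring
    rw [e] at h2
    linarith

/-! ### Theorem 2 (i): from a Cesàro bound to uniform positivity on the odd axis sites -/

/-- **[LeesTaggi2021, Thm 2 (i)] as proved in §5, finite form** (ground state, `d = 2`, every spin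
`n/2`, torus of side `2k`): if the staggered Cesàro sum exceeds `φ (2k)² + (n/2)² (2r+1)(2k)` with
`0 ≤ φ` and `r + 1 ≤ k`, then the Néel correlation is at least `φ` at EVERY odd axis site `m ≤ r`:
`φ ≤ -c(m, 0)`. Proof as printed: a site `(a, b)` at axis distance `> r` from the origin with
`(-1)^{a+b} c(a, b) ≥ φ` exists by counting (`|c| ≤ (n/2)²` on the `2r+1` rows near the origin);
fold `a` into `(r, k]` by the torus reflection; axis domination (odd `a`) or the average bound
(even `a`) moves the value `φ` onto an odd axis site `m₀ ≥ r`; the monotone chain brings it down to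
every odd `m ≤ r`. [cite: LeesTaggi2021, Thm 2 (i), §5] [cite: KLS1988JSP, eq. (25)] -/
theorem leesTaggi_uniformPositivity_oddAxis (k n r : ℕ) [NeZero (2 * k)] (hr : r + 1 ≤ k) {φ : ℝ}
    (hφ : 0 ≤ φ)
    (hS : φ * (2 * k : ℝ) ^ 2 + ((n : ℝ) / 2) ^ 2 * (2 * r + 1) * (2 * k) <
      ∑ a ∈ range (2 * k), ∑ b ∈ range (2 * k),
        (-1 : ℝ) ^ (a + b) * heisRedCorr2 (2 * k) n a b)
    {m : ℕ} (hm : Odd m) (hmr : m ≤ r) :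
    φ ≤ -heisRedCorr2 (2 * k) n m 0 := by
  set M : ℝ := ((n : ℝ) / 2) ^ 2 with hM
  set G : ℕ → ℕ → ℝ := fun a b => (-1 : ℝ) ^ (a + b) * heisRedCorr2 (2 * k) n a b with hG
  have hGle : ∀ a b, G a b ≤ M := by
    intro a b
    have h := heisRedCorr2_abs_le (2 * k) n a b
    have : G a b ≤ |heisRedCorr2 (2 * k) n a b| := by
      refine le_trans (le_abs_self _) (le_of_eq ?_)
      rw [hG]; dsimp only
      rw [abs_mul, abs_pow, abs_neg, abs_one, one_pow, one_mul]
    exact this.trans h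
  -- Step 1 (counting): a far site with a large value
  have hex : ∃ a b, r + 1 ≤ a ∧ a + r < 2 * k ∧ φ ≤ G a b := by
    by_contra hne
    have hlt : ∀ a, r + 1 ≤ a → a + r < 2 * k → ∀ b, G a b ≤ φ := by
      intro a ha1 ha2 b
      by_contra h
      exact hne ⟨a, b, ha1, ha2, le_of_lt (not_le.mp h)⟩
    -- every row is at most `2k·M`, a middle row at most `2k·φ`
    have rowM : ∀ a, ∑ b ∈ range (2 * k), G a b ≤ (2 * k : ℕ) • M := fun a =>
      (sum_le_card_nsmul _ _ _ fun b _ => hGle a b).trans_eq (by rw [card_range])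
    have rowφ : ∀ a ∈ Ico (r + 1) (2 * k - r), ∑ b ∈ range (2 * k), G a b ≤ (2 * k : ℕ) • φ := by
      intro a ha
      rw [mem_Ico] at ha
      exact (sum_le_card_nsmul _ _ _ fun b _ => hlt a ha.1 (by omega) b).trans_eq (by rw [card_range])
    have split : ∑ a ∈ range (2 * k), ∑ b ∈ range (2 * k), G a b =
        (∑ a ∈ range (r + 1), ∑ b ∈ range (2 * k), G a b) +
          ((∑ a ∈ Ico (r + 1) (2 * k - r), ∑ b ∈ range (2 * k), G a b) +
            ∑ a ∈ Ico (2 * k - r) (2 * k), ∑ b ∈ range (2 * k), G a b) := by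
      rw [sum_Ico_consecutive _ (by omega) (by omega), sum_range_add_sum_Ico _ (by omega)]
    have b1 : ∑ a ∈ range (r + 1), ∑ b ∈ range (2 * k), G a b ≤ (r + 1 : ℕ) • ((2 * k : ℕ) • M) :=
      (sum_le_card_nsmul _ _ _ fun a _ => rowM a).trans_eq (by rw [card_range])
    have b2 : ∑ a ∈ Ico (r + 1) (2 * k - r), ∑ b ∈ range (2 * k), G a b ≤
        (2 * k - r - (r + 1) : ℕ) • ((2 * k : ℕ) • φ) :=
      (sum_le_card_nsmul _ _ _ fun a ha => rowφ a ha).trans_eq (by rw [Nat.card_Ico])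
    have b3 : ∑ a ∈ Ico (2 * k - r) (2 * k), ∑ b ∈ range (2 * k), G a b ≤
        (2 * k - (2 * k - r) : ℕ) • ((2 * k : ℕ) • M) :=
      (sum_le_card_nsmul _ _ _ fun a _ => rowM a).trans_eq (by rw [Nat.card_Ico])
    have hMnn : 0 ≤ M := by positivity
    have e1 : ((2 * k - r - (r + 1) : ℕ) : ℝ) ≤ 2 * k := by
      have : 2 * k - r - (r + 1) ≤ 2 * k := by omega
      exact_mod_cast this
    have e2 : ((2 * k - (2 * k - r) : ℕ) : ℝ) = r := by
      have : 2 * k - (2 * k - r) = r := by omega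
      rw [this]
    simp only [nsmul_eq_mul, Nat.cast_add, Nat.cast_mul, Nat.cast_ofNat, Nat.cast_one] at b1 b2 b3
    rw [e2] at b3
    have hk : (0 : ℝ) ≤ 2 * k := by positivity
    have b2' : ∑ a ∈ Ico (r + 1) (2 * k - r), ∑ b ∈ range (2 * k), G a b ≤ 2 * k * (2 * k * φ) :=
      b2.trans (mul_le_mul_of_nonneg_right e1 (by positivity))
    have : ∑ a ∈ range (2 * k), ∑ b ∈ range (2 * k), G a b ≤
        φ * (2 * k : ℝ) ^ 2 + M * (2 * r + 1) * (2 * k) := by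
      rw [split]; nlinarith [b1, b2', b3]
    exact absurd hS (not_lt.mpr this)
  obtain ⟨a, b, ha1, ha2, hab⟩ := hex
  -- Step 2 (fold into `(r, k]` by the torus reflection `a ↦ 2k - a`)
  have hsq : ∀ x : ℕ, (-1 : ℝ) ^ x * (-1 : ℝ) ^ x = 1 := fun x => by
    rw [← pow_add, ← two_mul, pow_mul]; norm_num
  obtain ⟨a', ha'1, ha'2, hGa'⟩ : ∃ a', r + 1 ≤ a' ∧ a' ≤ k ∧ φ ≤ G a' b := by
    by_cases hak : a ≤ k
    · exact ⟨a, ha1, hak, hab⟩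
    · refine ⟨2 * k - a, by omega, by omega, ?_⟩
      have hc := heisRedCorr2_two_mul_sub k n (a := a) (by omega) (by omega) b
      have hprod : (-1 : ℝ) ^ (2 * k - a) * (-1 : ℝ) ^ a = 1 := by
        rw [← pow_add, Nat.sub_add_cancel (by omega : a ≤ 2 * k), pow_mul]; norm_num
      have hsgn : (-1 : ℝ) ^ (2 * k - a) = (-1 : ℝ) ^ a :=
        calc (-1 : ℝ) ^ (2 * k - a) = (-1 : ℝ) ^ (2 * k - a) * ((-1 : ℝ) ^ a * (-1 : ℝ) ^ a) := by
              rw [hsq, mul_one]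
          _ = ((-1 : ℝ) ^ (2 * k - a) * (-1 : ℝ) ^ a) * (-1 : ℝ) ^ a := by ring
          _ = (-1 : ℝ) ^ a := by rw [hprod, one_mul]
      have : G (2 * k - a) b = G a b := by
        simp only [hG, pow_add, hsgn, hc]
      rw [this]; exact hab
  -- Step 3 (onto the odd axis): an odd axis site `m₀ ∈ [r, k]` with `φ ≤ -c(m₀, 0)`
  obtain ⟨m₀, hm₀odd, hm₀r, hm₀k, hφm₀⟩ : ∃ m₀, Odd m₀ ∧ r ≤ m₀ ∧ m₀ ≤ k ∧
      φ ≤ -heisRedCorr2 (2 * k) n m₀ 0 := by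
    rcases Nat.even_or_odd a' with ⟨i, hi⟩ | ⟨i, hi⟩
    · -- even `a' = 2i' + 2` (note `a' ≥ 1`): the average bound
      obtain ⟨i', rfl⟩ : ∃ i', i = i' + 1 := ⟨i - 1, by omega⟩
      have ha' : a' = 2 * i' + 2 := by omega
      have hav := leesTaggi_axisAverage_even k n (i := i') (by omega) b
      rw [← ha'] at hav
      have hmax : φ ≤ (-heisRedCorr2 (2 * k) n (2 * i' + 1) 0 - heisRedCorr2 (2 * k) n (2 * i' + 3) 0) / 2 :=
        hGa'.trans hav
      by_cases hA : φ ≤ -heisRedCorr2 (2 * k) n (2 * i' + 1) 0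
      · exact ⟨2 * i' + 1, ⟨i', rfl⟩, by omega, by omega, hA⟩
      · have hB : φ ≤ -heisRedCorr2 (2 * k) n (2 * i' + 3) 0 := by
          have hA' := not_le.mp hA
          linarith
        by_cases htop : 2 * i' + 3 ≤ k
        · exact ⟨2 * i' + 3, ⟨i' + 1, by ring⟩, by omega, htop, hB⟩
        · -- `a' = k` (even), `a' + 1 = k + 1` folds to `k - 1`
          have hk' : 2 * i' + 3 = 2 * k - (2 * k - (2 * i' + 3)) := by omega
          have hfold := heisRedCorr2_two_mul_sub k n (a := 2 * k - (2 * i' + 3)) (by omega) (by omega) 0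
          refine ⟨2 * k - (2 * i' + 3), ?_, by omega, by omega, ?_⟩
          · exact ⟨i' , by omega⟩
          · rw [← hfold, ← hk']; exact hB
    · -- odd `a' = 2i + 1`: axis domination
      have hdom := leesTaggi_axisDomination_odd k n (i := i) (by omega) b
      rw [← hi] at hdom
      exact ⟨a', ⟨i, hi⟩, by omega, ha'2, hGa'.trans hdom⟩
  -- Step 4 (monotone chain down to `m ≤ r ≤ m₀`)
  exact hφm₀.trans (heisRedCorr2_oddAxis_chain k n hm hm₀odd (by omega) hm₀k)

/-- The same conclusion along the second axis: `φ ≤ -c(0, m)` for odd `m ≤ r`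
(`c(a, b) = c(b, a)`). [cite: LeesTaggi2021, Thm 2 (i), §5] -/
theorem leesTaggi_uniformPositivity_oddAxis_snd (k n r : ℕ) [NeZero (2 * k)] (hr : r + 1 ≤ k)
    {φ : ℝ} (hφ : 0 ≤ φ)
    (hS : φ * (2 * k : ℝ) ^ 2 + ((n : ℝ) / 2) ^ 2 * (2 * r + 1) * (2 * k) <
      ∑ a ∈ range (2 * k), ∑ b ∈ range (2 * k),
        (-1 : ℝ) ^ (a + b) * heisRedCorr2 (2 * k) n a b)
    {m : ℕ} (hm : Odd m) (hmr : m ≤ r) :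
    φ ≤ -heisRedCorr2 (2 * k) n 0 m := by
  rw [heisRedCorr2_swap]
  exact leesTaggi_uniformPositivity_oddAxis k n r hr hφ hS hm hmr

/-- **[LeesTaggi2021, Thm 2 (i)], asymptotic form as printed** (ground state, `d = 2`, every spin
`n/2`): if the staggered Cesàro sum is at least `C₁ (2k)²` for all large `k` (Néel long-range order
along the even tori — a HYPOTHESIS here), then for every `0 ≤ φ < C₁` there is `ε > 0` such that for
all large `k` and every odd `m ≤ ε k`, `φ ≤ -c_{2k}(m, 0)` ("there exists `ε > 0` such that for any
odd integer `n ∈ (0, εL)` … `G_L(o, n e₁) ≥ φ`"; the printed restriction `φ < C₁/2` is not needed in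
`d = 2` with this bookkeeping). [cite: LeesTaggi2021, Thm 2 (i), §5] -/
theorem leesTaggi_uniformPositivity_oddAxis_eventually (n : ℕ) {C₁ φ : ℝ} (hφ : 0 ≤ φ)
    (hφC : φ < C₁)
    (hLRO : ∀ᶠ k : ℕ in Filter.atTop, C₁ * (2 * k : ℝ) ^ 2 ≤
      ∑ a ∈ range (2 * k), ∑ b ∈ range (2 * k), (-1 : ℝ) ^ (a + b) * heisRedCorr2 (2 * k) n a b) :
    ∃ ε : ℝ, 0 < ε ∧ ∀ᶠ k : ℕ in Filter.atTop, ∀ m : ℕ, Odd m → (m : ℝ) ≤ ε * k →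
      φ ≤ -heisRedCorr2 (2 * k) n m 0 := by
  set M : ℝ := ((n : ℝ) / 2) ^ 2 with hM
  have hMnn : 0 ≤ M := by positivity
  set δ : ℝ := C₁ - φ with hδ
  have hδpos : 0 < δ := by rw [hδ]; linarith
  set ε : ℝ := min (1 / 2) (δ / (2 * M + 2)) with hε
  have hεpos : 0 < ε := lt_min (by norm_num) (by positivity)
  have hεhalf : ε ≤ 1 / 2 := min_le_left _ _
  have hεδ : ε * (2 * M + 2) ≤ δ := (le_div_iff₀ (by positivity)).mp (min_le_right _ _)
  refine ⟨ε, hεpos, ?_⟩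
  have hK : ∀ᶠ k : ℕ in Filter.atTop, (M + 1) / δ + 2 ≤ (k : ℝ) :=
    tendsto_natCast_atTop_atTop.eventually_ge_atTop _
  filter_upwards [hLRO, hK] with k hk hKk
  intro m hm hmε
  have hkpos : (0 : ℝ) < k := by
    have : (0 : ℝ) < (M + 1) / δ + 2 := by positivity
    linarith
  have hk1 : 1 ≤ k := by exact_mod_cast (show (0 : ℝ) < k from hkpos)
  haveI : NeZero (2 * k) := ⟨by omega⟩
  -- the range `r = ⌊ε k⌋`
  set r : ℕ := ⌊ε * k⌋₊ with hr
  have hεk : 0 ≤ ε * k := by positivity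
  have hrle : (r : ℝ) ≤ ε * k := Nat.floor_le hεk
  have hmr : m ≤ r := Nat.le_floor hmε
  have hr1 : r + 1 ≤ k := by
    have : (r : ℝ) ≤ k / 2 := hrle.trans (by nlinarith)
    have h' : (r : ℝ) < k := by linarith
    exact_mod_cast h'
  refine leesTaggi_uniformPositivity_oddAxis k n r hr1 hφ (lt_of_lt_of_le ?_ hk) hm hmr
  -- the counting margin: `M (2r+1)(2k) < δ (2k)²` for `k > M/δ`
  have h3 : M < δ * k := by
    have : (M + 1) / δ ≤ k := by linarith
    have h' := (div_le_iff₀ hδpos).mp this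
    rw [mul_comm] at h'
    linarith
  have h2 : 2 * M * ε ≤ δ := by nlinarith
  have hk0 : (0 : ℝ) ≤ k := hkpos.le
  have step1 : M * (2 * r + 1) * (2 * k) ≤ M * (2 * (ε * k) + 1) * (2 * k) := by
    have : (2 * (r : ℝ) + 1) ≤ 2 * (ε * k) + 1 := by linarith
    have hM2k : 0 ≤ M * (2 * k) := by positivity
    nlinarith
  have step2 : M * (2 * (ε * k) + 1) * (2 * k) < δ * (2 * k) ^ 2 := by
    nlinarith
  rw [hδ] at step2
  rw [← hM]
  linarith [step1, step2]

end Literature.MathematicalPhysics.QuantumLattice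

end
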